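import Literature.Geometry.Lorentzian.LeviCivitaCurvature
import Literature.Geometry.Lorentzian.EinsteinProofs
import Literature.Geometry.Lorentzian.CompleteStationaryVacuumFlatProofs
import HarnessLib

/-!
# Second derivatives of a Killing field: `∇_V(∇X) = R(V, X)`, `Hess ⟨X,X⟩`, `□⟨X,X⟩`
(O'Neill 1983, Ch. 9, Exercises 8–9)

Proved identities (no named facts) about a Killing field `X` of a `C^n` pseudo-Riemannian metric
`g`, `n ≥ 2`, in the vocabulary of `LeviCivita.lean` / `Curvature.lean`:

* `IsKillingField.val_leviCivita₂_skew` — the differentiated Killing equation: the second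
  covariant derivative `(∇²X)(V, W) = ∇_V ∇_W X - ∇_{∇_V W} X` is `g`-skew in `W` and the paired
  slot, `g((∇²X)(V,W), Z) = -g((∇²X)(V,Z), W)` (O'Neill 1983, Ch. 9, Prop. 9.25 differentiated
  once with the compatibility (D5) of Thm. 3.11).
* `riemann_apply_eq_leviCivita₂_sub` — the Ricci identity for a vector field:
  `R(V,W)X = (∇²X)(V,W) - (∇²X)(W,V)` (O'Neill 1983, Ch. 3, Lemma 3.35 with torsion-freeness).
* `IsKillingField.leviCivita₂_eq_riemann` — **O'Neill 1983, Ch. 9, Exercise 8**: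
  for a Killing field `X`, `D_V(DX) = R_{XV}`, i.e. with the curvature convention
  `R(X,Y)Z = ∇_X ∇_Y Z - ∇_Y ∇_X Z - ∇_{[X,Y]} Z` of `Curvature.lean` (O'Neill's `R_{XY} = -R(X,Y)`),
  `∇_V ∇_W X - ∇_{∇_V W} X = R(V, X) W` (Wald 1984, (C.3.6): `∇_a ∇_b ξ_c = -R_{bcad} ξ^d`;
  Petersen, *Riemannian Geometry*, the "Killing identity" `∇²_{V,W} X = -R(X,V)W`). The printed
  proof (the standard one): the differentiated Killing equation makes
  `T(V,W,Z) = g((∇²X)(V,W), Z)` skew in `(W,Z)`, the Ricci identity gives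
  `T(V,W,Z) - T(W,V,Z) = g(R(V,W)X, Z)`, and braiding the three slots,
  `2 T(V,W,Z) = g(R(V,W)X,Z) + g(R(Z,W)X,V) - g(R(V,Z)X,W) = 2 g(R(V,X)W, Z)` by pair symmetry and
  the first Bianchi identity (O'Neill 1983, Prop. 3.36).
* `IsKillingField.val_leviCivita₂_eq` — the paired form `g(∇_V ∇_W X - ∇_{∇_V W} X, Z) =
  g(R(V,X)W, Z)`; `IsKillingField.leviCivita_leviCivita_self_eq` — the case `W = X`.
* `tensorialAt_leviCivita₂` — `(∇²X)(V₀, W)` is tensorial in `W` (Mathlib's `TensorialAt`), the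
  reduction of the general statement to canonically extended vectors.
* `IsKillingField.hessian_val_self_apply`, `IsKillingField.hessian_val_self_eq` — **O'Neill
  1983, Ch. 9, Exercise 9 (b)** (doubled, `f = ⟨X,X⟩` instead of `½⟨X,X⟩`; Ex. 9 (a),
  `d⟨X,X⟩(w) = 2 g(∇_w X, X)`, is `IsKillingField.mvfderiv_val_self_apply` of
  `CompleteStationaryVacuumFlatProofs.lean`):
  `Hess ⟨X,X⟩ (V,W) = 2 g(∇_V X, ∇_W X) - 2 g(R(V,X)X, W) = -2 g(∇_{∇_V X} X, W) - 2 g(R(V,X)X, W)`.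
* `trace_compLeft_toBilinForm` — `tr_g ((v,w) ↦ g(L v, w)) = tr L`;
  `IsKillingField.dalembertian_val_self` — **O'Neill 1983, Ch. 9, Exercise 9 (c)** (doubled):
  `□ ⟨X,X⟩ = -2 tr(∇X ∘ ∇X) - 2 Ric(X,X)`.

These are the identities behind the reduction of the (vacuum) Einstein equations of a static or
stationary space-time to equations on the orbit data — the lapse equation `Δ_γ V = 0` of a static
vacuum metric `-V² dt² + γ`, `Ric(X,X) ↔ ΔV` (O'Neill 1983, Ch. 9, Ex. 9; Chruściel–Costa–Heusler
2012, §3.1; Anderson 2000, §1.2, (1.4)) — and behind Bochner's theorem (O'Neill, Ex. 10); they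
are consumed by `StaticBlackHoleUniquenessProofs.lean`. Everything is proved; there are no named
facts in this file.

## References

* [ONeill1983] B. O'Neill, *Semi-Riemannian geometry with applications to relativity*, Academic
  Press 1983: Ch. 3, Thm. 3.11, Lemma 3.35, Prop. 3.36; Ch. 9, Def. 9.22, Prop. 9.25,
  Exercises 8–9 (p. 241 of the 1983 printing's exercise list of Ch. 9).
* [Wald1984] R. M. Wald, *General Relativity*, University of Chicago Press 1984, App. C.3,
  (C.3.1), (C.3.6).
-/

noncomputable section

open Bundle Set NormedSpace FiberBundle VectorField
open scoped Manifold ContDiff Topology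

namespace Literature.Geometry.Lorentzian

variable {E : Type*} [NormedAddCommGroup E] [NormedSpace ℝ E] {H : Type*} [TopologicalSpace H]
  {I : ModelWithCorners ℝ E H} {M : Type*} [TopologicalSpace M] [ChartedSpace H M]
  [IsManifold I ∞ M] {n : ℕ∞ω}

namespace PseudoRiemannianMetric

variable {g : PseudoRiemannianMetric I n E (TangentSpace I : M → Type _)}
  [FiniteDimensional ℝ E] [CompleteSpace E] [Fact (1 ≤ n)] [g.HasLeviCivita]
  {X : Π x : M, TangentSpace I x} {x : M}

/-! ### Regularity of `∇X` and of `y ↦ ∇_{W y} X` -/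

/-- For a `C²` vector field `X` (on all of `M`) of a `C^n` metric, `n ≥ 2`, the section
`∇X : y ↦ (v ↦ ∇_v X)` of `Hom(TM, TM)` is differentiable at every point (the Levi-Civita
connection is locally `C¹`, `isLocallyContMDiff_leviCivita_holds`; Gallot–Hulin–Lafontaine 2004,
Prop. 2.54). [cite: ONeill1983, Ch. 3, Thm. 3.11] -/
theorem mdifferentiableAt_totalCovDeriv_leviCivita (hn : 2 ≤ n) (hX2 : CMDiff 2 (T% X)) (x : M) :
    MDifferentiableAt I (I.prod 𝓘(ℝ, E →L[ℝ] E)) (g.leviCivita.totalCovDeriv X) x :=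
  have hLC : g.IsLeviCivita g.leviCivita := isLeviCivita_leviCivita_holds
  g.leviCivita.mdifferentiableAt_totalCovDeriv (hLC.isLocallyContMDiff_one hn) isOpen_univ
    (mem_univ x) hX2.contMDiffOn

/-- For a `C²` vector field `X` of a `C^n` metric, `n ≥ 2`, and a vector field `W` differentiable
at `x`, the field `y ↦ ∇_{W y} X` is differentiable at `x` (product rule for the bundle map
`∇X` applied to the section `W`, Mathlib's `MDifferentiableAt.clm_bundle_apply`). [folklore] -/
theorem mdifferentiableAt_leviCivita_apply (hn : 2 ≤ n) (hX2 : CMDiff 2 (T% X))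
    {W : Π y : M, TangentSpace I y} (hW : MDiffAt (T% W) x) :
    MDiffAt (T% (fun y ↦ g.leviCivita X y (W y))) x :=
  (mdifferentiableAt_totalCovDeriv_leviCivita hn hX2 x).clm_bundle_apply hW

omit [FiniteDimensional ℝ E] [CompleteSpace E] [Fact (1 ≤ n)] in
/-- A Killing field of a `C^n` metric with `n ≥ 2` is `C²`. O'Neill 1983, Ch. 9, Def. 9.22.
[cite: ONeill1983, Ch. 9, Def. 9.22] -/
theorem IsKillingField.contMDiff_two (hX : g.IsKillingField X) (hn : 2 ≤ n) : CMDiff 2 (T% X) :=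
  hX.contMDiff.of_le hn

/-! ### The differentiated Killing equation -/

/-- **The differentiated Killing equation.** For a Killing field `X` of a `C^n` metric, `n ≥ 2`,
vector fields `W, Z` differentiable at `x` and a tangent vector `V₀` at `x`,
`g(∇_{V₀} ∇_W X - ∇_{∇_{V₀} W} X, Z) = -g(∇_{V₀} ∇_Z X - ∇_{∇_{V₀} Z} X, W)`: the second covariant
derivative `(∇²X)(V₀, ·)` is `g`-skew. Differentiate the Killing equation
`g(∇_W X, Z) + g(W, ∇_Z X) = 0` (O'Neill 1983, Ch. 9, Prop. 9.25) along `V₀` using the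
compatibility `V g(A, B) = g(∇_V A, B) + g(A, ∇_V B)` of the Levi-Civita connection (Ch. 3,
Thm. 3.11 (D5)), and remove the first-order terms with the Killing equation once more.
[cite: ONeill1983, Ch. 9, Prop. 9.25 and Ex. 8] -/
theorem IsKillingField.val_leviCivita₂_skew (hX : g.IsKillingField X) (hn : 2 ≤ n)
    {W Z : Π y : M, TangentSpace I y} (hW : MDiffAt (T% W) x) (hZ : MDiffAt (T% Z) x)
    (V₀ : TangentSpace I x) :
    g.val x (g.leviCivita (fun y ↦ g.leviCivita X y (W y)) x V₀
        - g.leviCivita X x (g.leviCivita W x V₀)) (Z x) =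
      -g.val x (g.leviCivita (fun y ↦ g.leviCivita X y (Z y)) x V₀
        - g.leviCivita X x (g.leviCivita Z x V₀)) (W x) := by
  have hLC : g.IsLeviCivita g.leviCivita := isLeviCivita_leviCivita_holds
  have hX2 : CMDiff 2 (T% X) := hX.contMDiff_two hn
  set V : Π y : M, TangentSpace I y := FiberBundle.extend E V₀ with hVdef
  have hV : MDiffAt (T% V) x := mdifferentiableAt_extend ..
  have hVx : V x = V₀ := extend_apply_self E V₀
  have hXW : MDiffAt (T% (fun y ↦ g.leviCivita X y (W y))) x :=
    mdifferentiableAt_leviCivita_apply hn hX2 hW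
  have hXZ : MDiffAt (T% (fun y ↦ g.leviCivita X y (Z y))) x :=
    mdifferentiableAt_leviCivita_apply hn hX2 hZ
  -- the Killing equation as an identity of functions
  have hfun : (fun y ↦ g.val y (g.leviCivita X y (W y)) (Z y)) =
      -(fun y ↦ g.val y (W y) (g.leviCivita X y (Z y))) := by
    funext y
    simp only [Pi.neg_apply]
    have := hX.2 y (W y) (Z y)
    linarith
  -- differentiate along `V₀`
  have h1 : mvfderiv I (fun y ↦ g.val y (g.leviCivita X y (W y)) (Z y)) x (V x) =
      g.val x (g.leviCivita (fun y ↦ g.leviCivita X y (W y)) x (V x)) (Z x)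
        + g.val x (g.leviCivita X x (W x)) (g.leviCivita Z x (V x)) := hLC.2 hV hXW hZ
  have h2 : mvfderiv I (fun y ↦ g.val y (W y) (g.leviCivita X y (Z y))) x (V x) =
      g.val x (g.leviCivita W x (V x)) (g.leviCivita X x (Z x))
        + g.val x (W x) (g.leviCivita (fun y ↦ g.leviCivita X y (Z y)) x (V x)) := hLC.2 hV hW hXZ
  have h3 : mvfderiv I (fun y ↦ g.val y (g.leviCivita X y (W y)) (Z y)) x (V x) =
      -mvfderiv I (fun y ↦ g.val y (W y) (g.leviCivita X y (Z y))) x (V x) := by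
    rw [hfun, mvfderiv_neg, neg_apply]
  rw [hVx] at h1 h2 h3
  have k1 := hX.2 x (W x) (g.leviCivita Z x V₀)
  have k2 := hX.2 x (g.leviCivita W x V₀) (Z x)
  have s1 : g.val x (W x) (g.leviCivita X x (g.leviCivita Z x V₀)) =
      g.val x (g.leviCivita X x (g.leviCivita Z x V₀)) (W x) := g.symm x _ _
  have s2 : g.val x (W x) (g.leviCivita (fun y ↦ g.leviCivita X y (Z y)) x V₀) =
      g.val x (g.leviCivita (fun y ↦ g.leviCivita X y (Z y)) x V₀) (W x) := g.symm x _ _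
  simp only [map_sub, sub_apply]
  linarith

/-! ### The Ricci identity for a vector field -/

/-- **Ricci identity for a vector field.** For a `C^n` metric, `n ≥ 2`, a vector field `X` of
class `C²` on `M`, and vector fields `V, W` differentiable at `x`:
`R(V,W)X = (∇_V ∇_W X - ∇_{∇_V W} X) - (∇_W ∇_V X - ∇_{∇_W V} X)` at `x` — the definition
`R(V,W)X = ∇_V ∇_W X - ∇_W ∇_V X - ∇_{[V,W]} X` (O'Neill 1983, Ch. 3, Lemma 3.35; the tensor is
computed by any fields through the given vectors, `curvature_apply_holds`) combined with
torsion-freeness `[V,W] = ∇_V W - ∇_W V` (Thm. 3.11 (D4)). [cite: ONeill1983, Ch. 3, Lemma 3.35] -/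
theorem riemann_apply_eq_leviCivita₂_sub (hn : 2 ≤ n) (hX2 : CMDiff 2 (T% X))
    {V W : Π y : M, TangentSpace I y} (hV : MDiffAt (T% V) x) (hW : MDiffAt (T% W) x) :
    g.riemann x (V x) (W x) (X x) =
      (g.leviCivita (fun y ↦ g.leviCivita X y (W y)) x (V x)
          - g.leviCivita X x (g.leviCivita W x (V x)))
        - (g.leviCivita (fun y ↦ g.leviCivita X y (V y)) x (W x)
          - g.leviCivita X x (g.leviCivita V x (W x))) := by
  have hLC : g.IsLeviCivita g.leviCivita := isLeviCivita_leviCivita_holds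
  have hI3 : IsManifold I (minSmoothness ℝ 3) M := by
    rw [minSmoothness_of_isRCLikeNormedField]; infer_instance
  have hreg : g.leviCivita.IsLocallyContMDiff 1 := hLC.isLocallyContMDiff_one hn
  have hX2' : CMDiffAt (minSmoothness ℝ 2) (T% X) x := by
    rw [minSmoothness_of_isRCLikeNormedField]; exact hX2 x
  have htor : g.leviCivita W x (V x) - g.leviCivita V x (W x) = mlieBracket I V W x :=
    (g.leviCivita.torsion_eq_zero_iff).1 hLC.1 hV hW
  change g.leviCivita.curvature x (V x) (W x) (X x) = _
  rw [g.leviCivita.curvature_apply_of_isLocallyContMDiff hreg hV hW hX2']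
  simp only [CovariantDerivative.curvatureAux, ← htor, map_sub]
  abel

/-! ### O'Neill 1983, Ch. 9, Exercise 8: `D_V(DX) = R_{XV}` -/

/-- **Second covariant derivatives of a Killing field on extended vectors.** The case
`W = extend W₀` of `IsKillingField.leviCivita₂_eq_riemann` (proof of O'Neill 1983, Ch. 9, Ex. 8
on the canonical local extensions of three tangent vectors: skewness from the differentiated
Killing equation, the Ricci identity, pair symmetry and the first Bianchi identity).
[cite: ONeill1983, Ch. 9, Ex. 8] -/
theorem IsKillingField.leviCivita₂_extend_eq_riemann (hX : g.IsKillingField X) (hn : 2 ≤ n)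
    (V₀ W₀ : TangentSpace I x) :
    g.leviCivita (fun y ↦ g.leviCivita X y (FiberBundle.extend E W₀ y)) x V₀
        - g.leviCivita X x (g.leviCivita (FiberBundle.extend E W₀) x V₀) =
      g.riemann x V₀ (X x) W₀ := by
  have hLC : g.IsLeviCivita g.leviCivita := isLeviCivita_leviCivita_holds
  have hX2 : CMDiff 2 (T% X) := hX.contMDiff_two hn
  -- `S a b = (∇²X)(a, extend b)` and its pairing `T a b c = g(S a b, c)`
  set S : TangentSpace I x → TangentSpace I x → TangentSpace I x := fun a b ↦
    g.leviCivita (fun y ↦ g.leviCivita X y (FiberBundle.extend E b y)) x a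
      - g.leviCivita X x (g.leviCivita (FiberBundle.extend E b) x a) with hS
  set T : TangentSpace I x → TangentSpace I x → TangentSpace I x → ℝ := fun a b c ↦
    g.val x (S a b) c with hT
  set R : TangentSpace I x → TangentSpace I x → TangentSpace I x → TangentSpace I x → ℝ :=
    fun a b c d ↦ g.val x (g.riemann x a b c) d with hR
  have hext : ∀ a : TangentSpace I x, MDiffAt (T% (FiberBundle.extend E a)) x := fun a ↦
    mdifferentiableAt_extend ..
  -- skewness in the last two slots (differentiated Killing equation)
  have skew : ∀ a b c, T a b c = -T a c b := by
    intro a b c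
    have h := hX.val_leviCivita₂_skew hn (hext b) (hext c) a
    simp only [extend_apply_self] at h
    simpa only [hT, hS] using h
  -- the Ricci identity
  have ric : ∀ a b c, T a b c - T b a c = R a b (X x) c := by
    intro a b c
    have h := riemann_apply_eq_leviCivita₂_sub (g := g) hn hX2 (hext a) (hext b)
    simp only [extend_apply_self] at h
    simp only [hT, hS, hR, h, map_sub, sub_apply]
  -- curvature symmetries (O'Neill 1983, Prop. 3.36)
  have A : ∀ a b c d, R a b c d = -R b a c d := fun a b c d ↦ by
    simp only [hR]
    exact val_curvature_antisymm x a b c d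
  have K : ∀ a b c d, R a b c d = -R a b d c := fun a b c d ↦
    hLC.val_curvature_skew hn x a b c d
  have P : ∀ a b c d, R a b c d = R c d a b := fun a b c d ↦
    hLC.val_curvature_pair_symm hn x a b c d
  have B : ∀ a b c d, R a b c d + R b c a d + R c a b d = 0 := fun a b c d ↦
    hLC.val_curvature_cyclic hn x a b c d
  -- conclude by nondegeneracy of `g_x`
  have key : ∀ c, g.val x (S V₀ W₀) c = g.val x (g.riemann x V₀ (X x) W₀) c := by
    intro c
    change T V₀ W₀ c = R V₀ (X x) W₀ c
    have e1 := skew V₀ W₀ c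
    have e2 := ric V₀ c W₀
    have e3 := skew c V₀ W₀
    have e4 := ric c W₀ V₀
    have e5 := skew W₀ c V₀
    have e6 := ric V₀ W₀ c
    linarith [A V₀ (X x) W₀ c, K (X x) V₀ W₀ c, P c W₀ (X x) V₀, P V₀ W₀ (X x) c,
      A V₀ c (X x) W₀, B (X x) c V₀ W₀, A V₀ (X x) c W₀, K (X x) V₀ c W₀]
  have hsub : g.val x (S V₀ W₀ - g.riemann x V₀ (X x) W₀) = 0 := by
    ext c
    simp only [map_sub, sub_apply, zero_apply, key c,
      sub_self]
  have := g.nondegenerate x (S V₀ W₀ - g.riemann x V₀ (X x) W₀) (by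
    intro c; simpa using DFunLike.congr_fun hsub c)
  exact sub_eq_zero.1 this

/-- **The second covariant derivative `(∇²X)(V₀, W) = ∇_{V₀} ∇_W X - ∇_{∇_{V₀} W} X` is
tensorial in `W`** (for `X` of class `C²`, `C^n` metric with `n ≥ 2`): it is additive and
`C¹`-function-linear in the field `W` (differentiable at `x`), hence depends only on `W x`
(Mathlib's `TensorialAt`; O'Neill 1983, Ch. 2, Prop. 2.2 and Ch. 3, Lemma 3.35 ff. — the Leibniz
terms `V₀(f) ∇_W X` of `∇_{V₀}(f ∇_W X)` and of `∇_{∇_{V₀}(f W)} X` cancel). [cite: ONeill1983, Ch. 2, Prop. 2.2] -/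
theorem tensorialAt_leviCivita₂ (hn : 2 ≤ n) (hX2 : CMDiff 2 (T% X)) (V₀ : TangentSpace I x) :
    TensorialAt I E (fun W : Π y : M, TangentSpace I y ↦
      g.leviCivita (fun y ↦ g.leviCivita X y (W y)) x V₀
        - g.leviCivita X x (g.leviCivita W x V₀)) x where
  smul := by
    intro f σ hf hσ
    have hS : MDiffAt (T% (fun y ↦ g.leviCivita X y (σ y))) x :=
      mdifferentiableAt_leviCivita_apply hn hX2 hσ
    have hfun : (fun y ↦ g.leviCivita X y ((f • σ) y)) = f • (fun y ↦ g.leviCivita X y (σ y)) := by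
      funext y
      simp only [Pi.smul_apply', map_smul]
    rw [hfun, g.leviCivita.isCovariantDerivativeOnUniv.leibniz hS hf,
      g.leviCivita.isCovariantDerivativeOnUniv.leibniz hσ hf]
    simp only [add_apply, smul_apply,
      ContinuousLinearMap.smulRight_apply, map_add, map_smul, smul_sub]
    abel
  add := by
    intro σ σ' hσ hσ'
    have hS : MDiffAt (T% (fun y ↦ g.leviCivita X y (σ y))) x :=
      mdifferentiableAt_leviCivita_apply hn hX2 hσ
    have hS' : MDiffAt (T% (fun y ↦ g.leviCivita X y (σ' y))) x :=
      mdifferentiableAt_leviCivita_apply hn hX2 hσ'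
    have hfun : (fun y ↦ g.leviCivita X y ((σ + σ') y)) =
        (fun y ↦ g.leviCivita X y (σ y)) + (fun y ↦ g.leviCivita X y (σ' y)) := by
      funext y
      simp only [Pi.add_apply, map_add]
    rw [hfun, g.leviCivita.isCovariantDerivativeOnUniv.add hS hS',
      g.leviCivita.isCovariantDerivativeOnUniv.add hσ hσ']
    simp only [add_apply, map_add]
    abel

/-- **O'Neill 1983, Ch. 9, Exercise 8: `D_V(DX) = R_{XV}` for a Killing field `X`.** For a
Killing field `X` of a `C^n` pseudo-Riemannian metric, `n ≥ 2`, a tangent vector `V₀` at `x` and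
a vector field `W` differentiable at `x`:
`∇_{V₀} ∇_W X - ∇_{∇_{V₀} W} X = R(V₀, X) W` at `x`, with `R(X,Y)Z = ∇_X ∇_Y Z - ∇_Y ∇_X Z -
∇_{[X,Y]} Z` (`Curvature.lean`; in O'Neill's convention `R_{XV} = -R(X,V) = R(V,X)`, so this is
`D_V(DX) = R_{XV}` verbatim; Wald 1984, (C.3.6), `∇_a ∇_b ξ_c = -R_{bcad} ξ^d`). Proof: both
sides are tensorial in `W` (`tensorialAt_leviCivita₂`), so `W` may be replaced by the canonical
extension of `W x` (`TensorialAt.pointwise`), where it is `leviCivita₂_extend_eq_riemann`.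
[cite: ONeill1983, Ch. 9, Ex. 8] -/
theorem IsKillingField.leviCivita₂_eq_riemann (hX : g.IsKillingField X) (hn : 2 ≤ n)
    {W : Π y : M, TangentSpace I y} (hW : MDiffAt (T% W) x) (V₀ : TangentSpace I x) :
    g.leviCivita (fun y ↦ g.leviCivita X y (W y)) x V₀ - g.leviCivita X x (g.leviCivita W x V₀) =
      g.riemann x V₀ (X x) (W x) := by
  have hX2 : CMDiff 2 (T% X) := hX.contMDiff_two hn
  have hΦ := tensorialAt_leviCivita₂ (g := g) (x := x) hn hX2 V₀
  have hW' : MDiffAt (T% (FiberBundle.extend E (W x))) x := mdifferentiableAt_extend ..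
  have h := hΦ.pointwise hW hW' (extend_apply_self E (W x)).symm
  rw [h]
  exact hX.leviCivita₂_extend_eq_riemann hn V₀ (W x)

/-- **O'Neill 1983, Ch. 9, Exercise 8, paired form**: for a Killing field `X` (`C^n` metric,
`n ≥ 2`), `g(∇_{V₀} ∇_W X - ∇_{∇_{V₀} W} X, Z₀) = g(R(V₀, X) W, Z₀)`.
[cite: ONeill1983, Ch. 9, Ex. 8] -/
theorem IsKillingField.val_leviCivita₂_eq (hX : g.IsKillingField X) (hn : 2 ≤ n)
    {W : Π y : M, TangentSpace I y} (hW : MDiffAt (T% W) x) (V₀ Z₀ : TangentSpace I x) :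
    g.val x (g.leviCivita (fun y ↦ g.leviCivita X y (W y)) x V₀
        - g.leviCivita X x (g.leviCivita W x V₀)) Z₀ =
      g.val x (g.riemann x V₀ (X x) (W x)) Z₀ := by
  rw [hX.leviCivita₂_eq_riemann hn hW V₀]

/-- **Second derivatives of a Killing field along itself**: `∇_{V₀} ∇_X X = R(V₀, X) X +
∇_{∇_{V₀} X} X` (O'Neill 1983, Ch. 9, Ex. 8 with `W = X`; the identity behind Ex. 9 (b),
`H^f(V,W) = ⟨D_V X, D_W X⟩ - ⟨R_{XV} X, W⟩ = -⟨D_V(D_X X), W⟩` for `f = ½⟨X,X⟩`).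
[cite: ONeill1983, Ch. 9, Ex. 8–9] -/
theorem IsKillingField.leviCivita_leviCivita_self_eq (hX : g.IsKillingField X) (hn : 2 ≤ n)
    (V₀ : TangentSpace I x) :
    g.leviCivita (fun y ↦ g.leviCivita X y (X y)) x V₀ =
      g.riemann x V₀ (X x) (X x) + g.leviCivita X x (g.leviCivita X x V₀) := by
  rw [← hX.leviCivita₂_eq_riemann hn (hX.mdifferentiableAt x) V₀]
  abel

/-! ### O'Neill 1983, Ch. 9, Exercise 9 (b): the Hessian of `⟨X, X⟩` -/

/-- **O'Neill 1983, Ch. 9, Exercise 9 (b) (doubled): the Hessian of `⟨X, X⟩` for a Killing field.**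
For a Killing field `X` of a `C^n` metric, `n ≥ 2`, and tangent vectors `V₀, W₀` at `x`:
`Hess(g(X,X))(V₀, W₀) = 2 g(∇_{V₀} X, ∇_{W₀} X) - 2 g(R(V₀, X) X, W₀)` — O'Neill's
`H^f(V,W) = ⟨D_V X, D_W X⟩ - ⟨R_{XV} X, W⟩` for `f = ½⟨X,X⟩` (his `R_{XV} = R(V,X)` here). Proof as
printed: `W f = 2 g(∇_W X, X)` (`mvfderiv_val_self_apply` of `CompleteStationaryVacuumFlatProofs.lean`, Ex. 9 (a)), differentiate along `V` with the
compatibility of `∇`, subtract `(∇_V W) f`, and insert Ex. 8 (`leviCivita₂_eq_riemann`) and the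
Killing equation. [cite: ONeill1983, Ch. 9, Ex. 9 (b)] -/
theorem IsKillingField.hessian_val_self_apply (hX : g.IsKillingField X) (hn : 2 ≤ n)
    (V₀ W₀ : TangentSpace I x) :
    g.hessian (fun z ↦ g.val z (X z) (X z)) x V₀ W₀ =
      2 * g.val x (g.leviCivita X x V₀) (g.leviCivita X x W₀)
        - 2 * g.val x (g.riemann x V₀ (X x) (X x)) W₀ := by
  have hLC : g.IsLeviCivita g.leviCivita := isLeviCivita_leviCivita_holds
  have hX2 : CMDiff 2 (T% X) := hX.contMDiff_two hn
  set V : Π y : M, TangentSpace I y := FiberBundle.extend E V₀ with hVdef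
  set W : Π y : M, TangentSpace I y := FiberBundle.extend E W₀ with hWdef
  have hV : MDiffAt (T% V) x := mdifferentiableAt_extend ..
  have hW : MDiffAt (T% W) x := mdifferentiableAt_extend ..
  have hVx : V x = V₀ := extend_apply_self E V₀
  have hWx : W x = W₀ := extend_apply_self E W₀
  have hXd : MDiffAt (T% X) x := hX.mdifferentiableAt x
  have hXW : MDiffAt (T% (fun y ↦ g.leviCivita X y (W y))) x :=
    mdifferentiableAt_leviCivita_apply hn hX2 hW
  -- `f = g(X, X)` is `C²` at `x`
  have hf : CMDiffAt 2 (fun z ↦ g.val z (X z) (X z)) x :=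
    g.contMDiffAt_val_apply hn (hX2 x) (hX2 x)
  have happ := hessian_apply_holds (g := g) hf hV hW
  rw [hVx, hWx] at happ
  rw [happ]
  simp only [hessianAux]
  -- `W f = 2 g(∇_W X, X)` as functions, then differentiate along `V₀`
  have hWf : (fun y ↦ mvfderiv I (fun z ↦ g.val z (X z) (X z)) y (W y)) =
      fun y ↦ 2 * g.val y (g.leviCivita X y (W y)) (X y) := by
    funext y
    exact hX.mvfderiv_val_self_apply y (W y)
  have hWf' : (fun y ↦ 2 * g.val y (g.leviCivita X y (W y)) (X y)) =
      (fun y ↦ g.val y (g.leviCivita X y (W y)) (X y)) +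
        (fun y ↦ g.val y (g.leviCivita X y (W y)) (X y)) := by
    funext y
    simp only [Pi.add_apply]
    ring
  have hd : MDiffAt (fun y ↦ g.val y (g.leviCivita X y (W y)) (X y)) x :=
    g.mdifferentiableAt_val_apply hXW hXd
  have hc : mvfderiv I (fun y ↦ g.val y (g.leviCivita X y (W y)) (X y)) x (V x) =
      g.val x (g.leviCivita (fun y ↦ g.leviCivita X y (W y)) x (V x)) (X x)
        + g.val x (g.leviCivita X x (W x)) (g.leviCivita X x (V x)) := hLC.2 hV hXW hXd
  rw [hVx, hWx] at hc
  rw [hWf, hWf', mvfderiv_add hd hd, add_apply, hVx, hc,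
    hX.mvfderiv_val_self_apply x (g.leviCivita W x V₀)]
  have h8 := hX.val_leviCivita₂_eq hn hW V₀ (X x)
  rw [hWx] at h8
  simp only [map_sub, sub_apply] at h8
  have hK := hLC.val_curvature_skew hn x V₀ (X x) W₀ (X x)
  change g.val x (g.riemann x V₀ (X x) W₀) (X x) = -g.val x (g.riemann x V₀ (X x) (X x)) W₀ at hK
  have hs : g.val x (g.leviCivita X x W₀) (g.leviCivita X x V₀) =
      g.val x (g.leviCivita X x V₀) (g.leviCivita X x W₀) := g.symm x _ _
  linarith

/-! ### O'Neill 1983, Ch. 9, Exercise 9 (c): `Δ ½⟨X,X⟩ = -tr(DX ∘ DX) - Ric(X,X)` -/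

omit [CompleteSpace E] [Fact (1 ≤ n)] [g.HasLeviCivita] in
/-- The metric trace of the bilinear form `(v, w) ↦ g(L v, w)` is the ordinary trace of the
endomorphism `L` (index raising undoes index lowering: `♯ ∘ ♭ ∘ L = L`). O'Neill 1983, Ch. 3,
pp. 60–61 and Lemma 3.36 (metric contraction). [cite: ONeill1983, Ch. 3, pp. 60–61] -/
theorem trace_compLeft_toBilinForm (x : M) (L : TangentSpace I x →ₗ[ℝ] TangentSpace I x) :
    g.trace x ((g.toBilinForm x).compLeft L) = LinearMap.trace ℝ (TangentSpace I x) L := by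
  simp only [trace]
  congr 1
  ext v
  simp only [LinearMap.coe_comp, Function.comp_apply, LinearEquiv.coe_coe]
  have h : (g.toBilinForm x).compLeft L v = g.flat x (L v) := by
    ext w
    simp [LinearMap.BilinForm.compLeft_apply, toBilinForm_apply, flat_apply]
  rw [h, sharp_flat]

/-- **The Hessian of `⟨X, X⟩` as a bilinear form** (O'Neill 1983, Ch. 9, Ex. 9 (b), doubled):
`Hess(g(X,X)) = -2 g((∇X ∘ ∇X) ·, ·) - 2 g(R(·, X) X, ·)`, where `∇X : v ↦ ∇_v X` — the first
term rewritten with the Killing equation, `g(∇_V X, ∇_W X) = -g(∇_{∇_V X} X, W)`.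
[cite: ONeill1983, Ch. 9, Ex. 9 (b)] -/
theorem IsKillingField.hessian_val_self_eq (hX : g.IsKillingField X) (hn : 2 ≤ n) (x : M) :
    g.hessian (fun z ↦ g.val z (X z) (X z)) x =
      (-2 : ℝ) • (g.toBilinForm x).compLeft
          ((g.leviCivita X x).toLinearMap ∘ₗ (g.leviCivita X x).toLinearMap)
        - (2 : ℝ) • (g.toBilinForm x).compLeft (g.leviCivita.ricciAux x (X x) (X x)) := by
  ext V₀ W₀
  rw [hX.hessian_val_self_apply hn V₀ W₀]
  simp only [LinearMap.sub_apply, LinearMap.smul_apply, LinearMap.BilinForm.compLeft_apply,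
    toBilinForm_apply, CovariantDerivative.ricciAux_apply, LinearMap.coe_comp,
    Function.comp_apply, ContinuousLinearMap.coe_coe, smul_eq_mul, riemann]
  have hk := hX.2 x (g.leviCivita X x V₀) W₀
  linarith

/-- **O'Neill 1983, Ch. 9, Exercise 9 (c) (doubled): `□ ⟨X, X⟩ = -2 tr(∇X ∘ ∇X) - 2 Ric(X, X)`
for a Killing field `X`** of a `C^n` pseudo-Riemannian metric, `n ≥ 2` — O'Neill's
`Δf = -trace(DX ∘ DX) - Ric(X,X)` for `f = ½⟨X,X⟩`, with `□ = tr_g Hess` (`dalembertian`) and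
`Ric(X,X) = tr (v ↦ R(v,X)X)`: the metric trace of `hessian_val_self_eq`
(`trace_compLeft_toBilinForm`). This is the identity ("`Ric(ξ,ξ) = -½ Δ(ξ·ξ) - …`", Wald 1984,
(C.3.6) contracted) from which the lapse equation of a static vacuum space-time and Bochner's
theorem (Ex. 10) follow. [cite: ONeill1983, Ch. 9, Ex. 9 (c)] -/
theorem IsKillingField.dalembertian_val_self (hX : g.IsKillingField X) (hn : 2 ≤ n) (x : M) :
    g.dalembertian (fun z ↦ g.val z (X z) (X z)) x =
      -2 * LinearMap.trace ℝ (TangentSpace I x)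
          ((g.leviCivita X x).toLinearMap ∘ₗ (g.leviCivita X x).toLinearMap)
        - 2 * g.ricci x (X x) (X x) := by
  simp only [dalembertian]
  rw [hX.hessian_val_self_eq hn x, trace_sub, trace_smul, trace_smul,
    trace_compLeft_toBilinForm, trace_compLeft_toBilinForm, ricci_apply,
    CovariantDerivative.ricci_apply]

end PseudoRiemannianMetric

end Literature.Geometry.Lorentzian

end
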